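import Summits.QuantumFields.BalabanUV.Beta.MeanValueFromPoisson
import Summits.QuantumFields.BalabanUV.Beta.TorusBoxSupersolution

/-!
# `Summit.QuantumFields.BalabanUV.Beta.TorusBallMeanValue` — the L¹ MEAN-VALUE BINDER ON A TORUS BOX from ONE pointwise bound on the
# Poisson kernels of the EUCLIDEAN LATTICE BALLS `C_s(x₀) = {|· − x₀| < s}` seen from the centre (constant bond weights) — step 3 of
# road P3's reduction of O.2 item (ii-b): the integer Euclidean radius `⌊|x − x₀|⌋` on the unit torus is 1-Lipschitz along the bonds,
# its balls sit inside the box, and `MeanValueFromPoisson` + the owner's box supersolution (file 15b) deliver the binder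

HONEST FRAMING (page 1 of everything in this cell).  Discharging `FlowStep.BetaPertH` would make Bałaban's ultraviolet
stability UNCONDITIONAL — a constructive-QFT result; it is NOT the continuum limit and NOT the Clay problem.  This module
discharges nothing of `BetaPertH`; it is [folklore] lattice arithmetic on the torus MODEL, kernel-checked, by CO-OWNER #3 of binder row D4
(unit `b2b-balaban-beta-d4-p3`, road P3 «reduction road», gen 12).  HONEST DEPENDENCY: continuum YM on T⁴ ⇐ BetaPertH ∧ nine spine
estimates (0/9 proved); BetaPertH ⇐ (D1) ∧ (D4) ∧ CAP+tail; G-an2-4 gates asym, D1 and NE2/3/4.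

THE POINT.  The owner's assembly (file 16) reduces the local-regularity datum `hreg` of the MODEL to the binder «for every centre `x₀`,
radius `r` with `2r + 2 ≤ N_μ`, and `z ≥ 0` with `W·z ≤ Nz` on the box `{dist(·, x₀) ≤ r}`: `z(x₀) ≤ C_MV·r^{−d}·Σ_{box} z`», `C_MV`
level-free.  THIS FILE proves that binder, for the unit torus `UT N` with its nearest-neighbour bonds and a CONSTANT bond weight
`c ≡ c₀ ≠ 0`, from ONE POINTWISE HYPOTHESIS on the Poisson kernels (`GraphPoissonKernel.poisson`) of the Euclidean lattice balls
`C_s(x₀) = {y : ⌊|y − x₀|⌋ < s} = {|y − x₀|² < s²}` (`|·|` the Euclidean length of the centred coordinate differences):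

  (HMB)  `poisson (C_s(x₀)) x₀ y ≤ K₀ / s^{d−1}`  for  `⌊r/2⌋ + 1 ≤ s ≤ r`  and  `⌊|y − x₀|⌋ = s`

— the harmonic-measure bound from the CENTRE, which for the simple nearest-neighbour weights on `ℤ^d` is the displayed Lemma 6.3.7
p. 130 of Lawler–Limic, *Random Walk: A Modern Introduction* (2010) («`H_{C_n}(x,y) ≤ c₂ n^{1−d}`, `x ∈ C_{n/4}`, `y ∈ ∂C_n`, `n`
large», their `C_n = {|z| < n}` for simple random walk, p. 126, and their `H_A(·,y)` = «the unique function harmonic on `A` equal to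
`δ(· − y)` on `∂A`», p. 123 = the tree's `poisson`); below half the period (`2r + 2 ≤ N_μ`) the Dirichlet problem of `C_s(x₀)` on
the torus is the same finite linear system as on `ℤ^d`.  (HMB) is NOT proved and NOT asserted here: it is the ONE residual LEAF of
(ii-b) for the MODEL with constant weights, to be typed and cross-read (ABSOLUTE RULE); here it is the hypothesis `hP`.
* §1 the integer Euclidean radius `erad x₀ x = ⌊√(Σ_ν δ_ν(x,x₀)²)⌋` (`sqRad` = the sum of the squared circular coordinate distances,
  in `ℕ`): `erad_self`, one lattice step changes `sqRad` by at most `2δ_μ + 1` (file 15a's `cdist_up_self` ∕ `circAbs_add_one_le`)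
  hence `erad` by at most one — **`erad_lipschitz`** (the hypothesis `hρ` of `MeanValueFromPoisson` for the torus bonds);
* §2 `dist_le_of_erad_le` (`⌊|y − x₀|⌋ ≤ r ⟹ dist(y, x₀) ≤ r`: the ball of radius `r + 1` minus its sphere sits in the box);
* §3 **`meanValue_box_of_poisson_bound`** — THE BINDER: `d ≥ 1`, `c ≡ c₀ ≠ 0`, `2r + 2 ≤ N_μ`, `1 ≤ r`, `z ≥ 0` with `W·z ≤ Nz`
  on the box of radius `r` about `x₀`, (HMB) with `K₀ ≥ 0` ⟹ `z(x₀) ≤ (2^d·K₀ / r^d)·Σ_{dist(y,x₀) ≤ r} z(y)` — via file 15b's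
  `exists_unit_supersolution_box` (any subset of the box inherits the unit supersolution) and `MeanValueFromPoisson.
  meanValue_of_poisson_bound` with `ρ = erad x₀`, `D` = the box, `s₂ = r`.

LOCATORS (shape only, nothing printed asserted; ABSOLUTE RULE): [Balaban1985BackgroundPropagators] Thm 3.1 (3.42) p. 397;
[Balaban1983RegularityDecay] Lemma 2.2 (2.17) pp. 577–578; [Balaban1984PropagatorsII] Prop. 2.2 (2.67) p. 234.  Row D4: NO class
change (critical-path width 0; D4 DISCHARGE NO DATE); NOT BetaPertH, NOT continuum, NOT Clay, NOT summit progress.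
-/

open scoped BigOperators
open Finset

namespace Summit.QuantumFields.BalabanUV.Beta.TorusBallMeanValue

open Literature.MathematicalPhysics.QuantumFieldTheory.Balaban1983to89
open Literature.MathematicalPhysics.QuantumFieldTheory.Balaban1983to89.B9Thm37GluePU (bsrc btgt bsrc_apply btgt_apply)
open B4TorusKernel.MultiPeriod (circAbs circAbs_nonneg)
open B4Sect5Torus (ccoord ccoord_cast circAbs_zero)
open B5TorusCover (UT)
open B5Leibniz121 (up dn up_dn)
open B5DirichletDg (dn_up)
open Summit.QuantumFields.BalabanUV.Beta.TorusBoxProfile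
open Summit.QuantumFields.BalabanUV.Beta.TorusBoxSupersolution (exists_unit_supersolution_box)
open Summit.QuantumFields.BalabanUV.Beta.GraphPoissonKernel (poisson)
open Summit.QuantumFields.BalabanUV.Beta.MeanValueFromPoisson (meanValue_of_poisson_bound)

noncomputable section

variable {d : ℕ} {N : Fin d → ℕ} [∀ i, NeZero (N i)]

/-! ## §1 The integer Euclidean radius on the unit torus and its Lipschitz property along the bonds -/

/-- The squared Euclidean length of the centred coordinate differences to `x₀`: `Σ_ν δ_ν(x,x₀)²` in `ℕ` (`δ_ν` = the circular
coordinate distance `ccoord`). MODEL object. [folklore] -/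
def sqRad (x₀ x : UT N) : ℕ := ∑ ν, ccoord N (UT.toSite N x) (UT.toSite N x₀) ν ^ 2

/-- The integer Euclidean radius `⌊|x − x₀|⌋ = ⌊√(sqRad x₀ x)⌋`. MODEL object. [folklore] -/
def erad (x₀ x : UT N) : ℕ := Nat.sqrt (sqRad x₀ x)

omit [∀ i, NeZero (N i)] in
/-- The centre has radius `0`. [folklore] -/
theorem erad_self (x₀ : UT N) : erad x₀ x₀ = 0 := by
  have h : sqRad x₀ x₀ = 0 := Finset.sum_eq_zero fun ν _ => by rw [B4Sect5Torus.ccoord_self]; rfl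
  rw [erad, h]
  rfl

/-- The coordinate distance as an integer is the circular distance of the coordinate difference. [folklore] -/
theorem ccoord_cast' (x x₀ : UT N) (ν : Fin d) :
    ((ccoord N (UT.toSite N x) (UT.toSite N x₀) ν : ℕ) : ℤ) =
      circAbs (N ν) (((UT.toSite N x ν).val : ℤ) - ((UT.toSite N x₀ ν).val : ℤ)) :=
  ccoord_cast (UT.one_le N) _ _ ν

omit [∀ i, NeZero (N i)] in
/-- Each coordinate distance is at most the integer radius: `δ_ν ≤ ⌊√(Σ δ²)⌋`. [folklore] -/
theorem ccoord_le_erad (x₀ x : UT N) (ν : Fin d) : ccoord N (UT.toSite N x) (UT.toSite N x₀) ν ≤ erad x₀ x := by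
  rw [erad, Nat.le_sqrt, ← pow_two]
  exact Finset.single_le_sum (f := fun ν => ccoord N (UT.toSite N x) (UT.toSite N x₀) ν ^ 2) (fun _ _ => Nat.zero_le _)
    (Finset.mem_univ ν)

/-- One step along `+e_μ` raises the squared radius by at most `2δ_μ + 1 ≤ 2·erad + 1`. [folklore] -/
theorem sqRad_up_le (x₀ x : UT N) (μ : Fin d) : sqRad x₀ (up x μ) ≤ sqRad x₀ x + 2 * erad x₀ x + 1 := by
  have hterm : ∀ ν, ccoord N (UT.toSite N (up x μ)) (UT.toSite N x₀) ν ^ 2 ≤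
      ccoord N (UT.toSite N x) (UT.toSite N x₀) ν ^ 2 + if ν = μ then 2 * erad x₀ x + 1 else 0 := by
    intro ν
    by_cases hν : ν = μ
    · subst hν
      rw [if_pos rfl]
      have h1 : ((ccoord N (UT.toSite N (up x ν)) (UT.toSite N x₀) ν : ℕ) : ℤ) ≤
          ccoord N (UT.toSite N x) (UT.toSite N x₀) ν + 1 := by
        rw [ccoord_cast', ccoord_cast', cdist_up_self]
        exact circAbs_add_one_le (UT.one_le N ν) _
      have h1' : ccoord N (UT.toSite N (up x ν)) (UT.toSite N x₀) ν ≤ ccoord N (UT.toSite N x) (UT.toSite N x₀) ν + 1 := by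
        exact_mod_cast h1
      have h2 := ccoord_le_erad x₀ x ν
      nlinarith
    · rw [if_neg hν, add_zero]
      have h1 : ((ccoord N (UT.toSite N (up x μ)) (UT.toSite N x₀) ν : ℕ) : ℤ) =
          ccoord N (UT.toSite N x) (UT.toSite N x₀) ν := by
        rw [ccoord_cast', ccoord_cast', cdist_up_ne x x₀ hν]
      have h1' : ccoord N (UT.toSite N (up x μ)) (UT.toSite N x₀) ν = ccoord N (UT.toSite N x) (UT.toSite N x₀) ν := by
        exact_mod_cast h1
      rw [h1']
  calc sqRad x₀ (up x μ) = ∑ ν, ccoord N (UT.toSite N (up x μ)) (UT.toSite N x₀) ν ^ 2 := rfl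
    _ ≤ ∑ ν, (ccoord N (UT.toSite N x) (UT.toSite N x₀) ν ^ 2 + if ν = μ then 2 * erad x₀ x + 1 else 0) :=
        Finset.sum_le_sum fun ν _ => hterm ν
    _ = sqRad x₀ x + 2 * erad x₀ x + 1 := by
        rw [Finset.sum_add_distrib, Finset.sum_ite_eq' Finset.univ μ, if_pos (Finset.mem_univ μ)]
        rfl

/-- One step along `−e_μ` raises the squared radius by at most `2·erad + 1`. [folklore] -/
theorem sqRad_dn_le (x₀ x : UT N) (μ : Fin d) : sqRad x₀ (dn x μ) ≤ sqRad x₀ x + 2 * erad x₀ x + 1 := by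
  have hterm : ∀ ν, ccoord N (UT.toSite N (dn x μ)) (UT.toSite N x₀) ν ^ 2 ≤
      ccoord N (UT.toSite N x) (UT.toSite N x₀) ν ^ 2 + if ν = μ then 2 * erad x₀ x + 1 else 0 := by
    intro ν
    by_cases hν : ν = μ
    · subst hν
      rw [if_pos rfl]
      have h1 : ((ccoord N (UT.toSite N (dn x ν)) (UT.toSite N x₀) ν : ℕ) : ℤ) ≤
          ccoord N (UT.toSite N x) (UT.toSite N x₀) ν + 1 := by
        rw [ccoord_cast', ccoord_cast', cdist_dn_self]
        exact circAbs_sub_one_le (UT.one_le N ν) _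
      have h1' : ccoord N (UT.toSite N (dn x ν)) (UT.toSite N x₀) ν ≤ ccoord N (UT.toSite N x) (UT.toSite N x₀) ν + 1 := by
        exact_mod_cast h1
      have h2 := ccoord_le_erad x₀ x ν
      nlinarith
    · rw [if_neg hν, add_zero]
      have h1 : ((ccoord N (UT.toSite N (dn x μ)) (UT.toSite N x₀) ν : ℕ) : ℤ) =
          ccoord N (UT.toSite N x) (UT.toSite N x₀) ν := by
        rw [ccoord_cast', ccoord_cast', cdist_dn_ne x x₀ hν]
      have h1' : ccoord N (UT.toSite N (dn x μ)) (UT.toSite N x₀) ν = ccoord N (UT.toSite N x) (UT.toSite N x₀) ν := by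
        exact_mod_cast h1
      rw [h1']
  calc sqRad x₀ (dn x μ) = ∑ ν, ccoord N (UT.toSite N (dn x μ)) (UT.toSite N x₀) ν ^ 2 := rfl
    _ ≤ ∑ ν, (ccoord N (UT.toSite N x) (UT.toSite N x₀) ν ^ 2 + if ν = μ then 2 * erad x₀ x + 1 else 0) :=
        Finset.sum_le_sum fun ν _ => hterm ν
    _ = sqRad x₀ x + 2 * erad x₀ x + 1 := by
        rw [Finset.sum_add_distrib, Finset.sum_ite_eq' Finset.univ μ, if_pos (Finset.mem_univ μ)]
        rfl

/-- From `S′ ≤ S + 2⌊√S⌋ + 1` to `⌊√S′⌋ ≤ ⌊√S⌋ + 1`. [folklore] -/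
theorem sqrt_le_succ_of_le {S S' : ℕ} (h : S' ≤ S + 2 * Nat.sqrt S + 1) : Nat.sqrt S' ≤ Nat.sqrt S + 1 := by
  have h1 := Nat.lt_succ_sqrt' S
  have h2 : S' < (Nat.sqrt S + 2) ^ 2 := by nlinarith
  have h3 := Nat.sqrt_lt'.mpr h2
  omega

/-- `erad (x + e_μ) ≤ erad x + 1`. [folklore] -/
theorem erad_up_le (x₀ x : UT N) (μ : Fin d) : erad x₀ (up x μ) ≤ erad x₀ x + 1 :=
  sqrt_le_succ_of_le (sqRad_up_le x₀ x μ)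

/-- `erad (x − e_μ) ≤ erad x + 1`. [folklore] -/
theorem erad_dn_le (x₀ x : UT N) (μ : Fin d) : erad x₀ (dn x μ) ≤ erad x₀ x + 1 :=
  sqrt_le_succ_of_le (sqRad_dn_le x₀ x μ)

/-- **The integer Euclidean radius is 1-Lipschitz along the torus bonds** `(y, μ) : y → y + e_μ` — the hypothesis `hρ` of
`MeanValueFromPoisson`. [folklore] -/
theorem erad_lipschitz (x₀ : UT N) :
    ∀ b : UT N × Fin d, erad x₀ (btgt b) ≤ erad x₀ (bsrc b) + 1 ∧ erad x₀ (bsrc b) ≤ erad x₀ (btgt b) + 1 := by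
  rintro ⟨y, μ⟩
  refine ⟨erad_up_le x₀ y μ, ?_⟩
  rw [bsrc_apply, btgt_apply]
  have h := erad_dn_le x₀ (up y μ) μ
  rwa [dn_up] at h

/-! ## §2 Euclidean balls sit in boxes -/

/-- `⌊|y − x₀|⌋ ≤ r ⟹ dist(y, x₀) ≤ r` (each circular coordinate distance is `≤ ⌊|y − x₀|⌋`, and `dist` is their maximum).
[folklore] -/
theorem dist_le_of_erad_le (x₀ y : UT N) {r : ℕ} (h : erad x₀ y ≤ r) : dist y x₀ ≤ r := by
  rw [UT.dist_eq]
  unfold B4Sect5Torus.tdist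
  have hsup : Finset.univ.sup (ccoord N (UT.toSite N y) (UT.toSite N x₀)) ≤ r :=
    Finset.sup_le fun ν _ => (ccoord_le_erad x₀ y ν).trans h
  exact_mod_cast hsup

/-! ## §3 THE BINDER on a torus box from the pointwise Poisson bound on the Euclidean balls -/

/-- **THE L¹ MEAN-VALUE BINDER ON A TORUS BOX FROM THE HARMONIC-MEASURE BOUND AT THE CENTRE.**  Unit torus `UT N`, `d ≥ 1`,
nearest-neighbour bonds `bsrc∕btgt`, CONSTANT bond weight `c ≡ c₀ ≠ 0`; centre `x₀`, radius `r ≥ 1` with `2r + 2 ≤ N_μ` for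
every `μ` (no wrap-around); `z ≥ 0` with `W·z ≤ Nz` on the box `{dist(·, x₀) ≤ r}`; and the POINTWISE POISSON BOUND (HMB):
`poisson (C_s(x₀)) x₀ y ≤ K₀/s^{d−1}` for `⌊r/2⌋ + 1 ≤ s ≤ r` and `⌊|y − x₀|⌋ = s`, where
`C_s(x₀) = {⌊|· − x₀|⌋ < s}` is the Euclidean lattice ball (`K₀ ≥ 0`).  Then `z(x₀) ≤ (2^d·K₀/r^d)·Σ_{dist(y,x₀) ≤ r} z(y)`.
(HMB) is the ONE residual leaf of O.2 item (ii-b) for the MODEL with constant weights (Lawler–Limic 2010, Lemma 6.3.7 p. 130, for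
the simple nearest-neighbour weights on `ℤ^d`; not asserted here).  Proof: `MeanValueFromPoisson.meanValue_of_poisson_bound` with
`ρ = erad x₀` (§1), `D` = the box (file 15b's `exists_unit_supersolution_box`), `s₂ = r`, and `{⌊|· − x₀|⌋ ≤ r} ⊆` box (§2).
[cite: Balaban1985BackgroundPropagators, Thm 3.1 (3.42) p.397] [folklore] -/
theorem meanValue_box_of_poisson_bound [NeZero d] {c : UT N × Fin d → ℝ} {c₀ : ℝ} (hc : ∀ b, c b = c₀) (hc₀ : c₀ ≠ 0)
    (x₀ : UT N) {r : ℕ} (hr1 : 1 ≤ r) (hr : ∀ μ, 2 * r + 2 ≤ N μ)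
    (z : UT N → ℝ) (hz0 : ∀ y, 0 ≤ z y)
    (hz : ∀ x ∈ univ.filter (fun x : UT N => dist x x₀ ≤ r),
      ((∑ b ∈ univ.filter (fun b : UT N × Fin d => btgt b = x), c b ^ 2) +
          ∑ b ∈ univ.filter (fun b : UT N × Fin d => bsrc b = x), c b ^ 2) * z x ≤
        ((∑ b ∈ univ.filter (fun b : UT N × Fin d => btgt b = x), c b ^ 2 * z (bsrc b)) +
          ∑ b ∈ univ.filter (fun b : UT N × Fin d => bsrc b = x), c b ^ 2 * z (btgt b)))
    {K₀ : ℝ} (hK₀ : 0 ≤ K₀)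
    (hP : ∀ s, r / 2 + 1 ≤ s → s ≤ r → ∀ y, erad x₀ y = s →
      poisson bsrc btgt c (univ.filter (fun y => erad x₀ y < s)) x₀ y ≤ K₀ / (s : ℝ) ^ (d - 1)) :
    z x₀ ≤ 2 ^ d * K₀ / (r : ℝ) ^ d * ∑ y ∈ univ.filter (fun y : UT N => dist y x₀ ≤ r), z y := by
  obtain ⟨w₀, hw₀0, -, hw₀⟩ := exists_unit_supersolution_box hc hc₀ x₀ hr
  have hd : 1 ≤ d := Nat.one_le_iff_ne_zero.mpr (NeZero.ne d)
  have hD : ∀ y, erad x₀ y < r → y ∈ univ.filter (fun x : UT N => dist x x₀ ≤ r) := fun y hy =>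
    mem_filter.mpr ⟨mem_univ _, dist_le_of_erad_le x₀ y hy.le⟩
  have hx : erad x₀ x₀ < r / 2 + 1 := by rw [erad_self]; omega
  have h := meanValue_of_poisson_bound bsrc btgt c (erad x₀) (erad_lipschitz x₀)
    (univ.filter (fun x : UT N => dist x x₀ ≤ r)) w₀ hw₀0 hw₀ hr1 hD z hz0 hz x₀ hx hd hK₀ hP
  refine h.trans (mul_le_mul_of_nonneg_left ?_ (by positivity))
  exact Finset.sum_le_sum_of_subset_of_nonneg
    (fun y hy => mem_filter.mpr ⟨mem_univ _, dist_le_of_erad_le x₀ y (mem_filter.mp hy).2⟩) (fun y _ _ => hz0 y)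

end

end Summit.QuantumFields.BalabanUV.Beta.TorusBallMeanValue
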